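import Summits.HodgeConjecture.HodgeCM.Model.ThetaSpaceInputPin_1

/-! PORT of `HodgeCM/Model/ThetaSpaceInputPin.lean` (HodgeCMPerL run 82) — part 2: continuation of `Summits.HodgeConjecture.HodgeCM.Model.ThetaSpaceInputPin_1` (split at a top-level declaration boundary by port_pkg.py; scope re-opened below; declarations unchanged). -/

-- port_pkg: scope re-opened for this part (file-level context, then the namespace/section stack open at the cut)
set_option autoImplicit false
noncomputable section
open MulAction NumberField
open Literature.Geometry.ComplexHyperbolic.BallModel (U21 Ball x₀)
open Literature.NumberTheory.Automorphic Literature.NumberTheory.Weil1964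
open Literature.NumberTheory.Automorphic.WeightForms (ClassMapDatum thetaClasses restrictHom IsLevelCorrected
  IsWeightMatched)
open Literature.AlgebraicGeometry.HodgeTheory
open Literature.AlgebraicGeometry.ShimuraVarieties
open Literature.NumberTheory.Automorphic.PicardCM
open HodgeCM.Model.SupplyResidual
open HodgeCM.Model.ThetaSpace
namespace HodgeCM
namespace Model
section Pin
variable (hHD : exists_isReal_hodgeModel) (hI : hodgePQ_independent_of_hodgeModel)
  (h₁ : BallQuotientUniformised)  (h₃ : CMAbelianVarietyRealised)
variable {L : CMField} {ι₁ : L →+* ℂ} {V : HermSpace3 L ι₁} {c : SeesawCtx L}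
variable (S : ∀ {L : CMField} {ι₁ : L →+* ℂ} (V : HermSpace3 L ι₁) (c : SeesawCtx L), ThetaAdelicSide V c)
/-- Off the regime the END STATE's `Θ_k(Γ)` at the pin is `{0}`. -/
theorem thetaOf_thetaSpaceInputOf_of_not_isAnisotropic (V : HermSpace3 L ι₁) (c : SeesawCtx L) (k : Fin 4)
    (Γ : Level V) (h : ¬ IsAnisotropic L V.Hm) :
    thetaOf _ (thetaClassInputOf _ (fun V c => thetaSpaceInputOf hHD hI h₁ h₃ S V c)) V c k Γ = {0} := by
  rw [thetaOf_thetaClassInputOf, thetaSpaceInputOf_of_not_isAnisotropic hHD hI h₁ h₃ S V c h]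
  exact thetaClasses_zeroClassMapDatum _ _ _ _ _

/-- (Ported verbatim from the HodgeCMPerL package; no docstring in the source.) -/
@[simp] theorem thetaSpaceInputIn_D (Sv : ThetaAdelicSide V c) (h : IsAnisotropic L V.Hm) (Γ : Level V) :
    (thetaSpaceInputIn hHD hI h₁ h₃ Sv h).D Γ =
      classMapDatumOf hHD hI h₁ h₃ Γ h (frameOf hHD hI h₁ h₃ Γ h) (MonoidHom.id U21)
        (isLevelCorrected_id (levelImage hHD hI h₁ h₃ Γ h) (stabilizer U21 x₀).subtype
          (BallForms.isPullbackCocycle_cotangentCocycle.weightOf x₀))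
        (isWeightMatched_id (stabilizer U21 x₀).subtype
          (BallForms.isPullbackCocycle_cotangentCocycle.weightOf x₀)) :=
  rfl

/-- (Ported verbatim from the HodgeCMPerL package; no docstring in the source.) -/
@[simp] theorem thetaSpaceInputIn_P (Sv : ThetaAdelicSide V c) (h : IsAnisotropic L V.Hm) :
    (thetaSpaceInputIn hHD hI h₁ h₃ Sv h).P = Sv.P := rfl

/-- (Ported verbatim from the HodgeCMPerL package; no docstring in the source.) -/
@[simp] theorem thetaSpaceInputIn_ιinf (Sv : ThetaAdelicSide V c) (h : IsAnisotropic L V.Hm) :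
    (thetaSpaceInputIn hHD hI h₁ h₃ Sv h).ιinf = fun _ => Sv.ιinf := rfl

/-- ((Θ-sat-K)) the saturation index of the pinned input is `satLevelRegimeOf V h Γ.K`. -/
@[simp] theorem thetaSpaceInputIn_KΓ (Sv : ThetaAdelicSide V c) (h : IsAnisotropic L V.Hm) (Γ : Level V) :
    (thetaSpaceInputIn hHD hI h₁ h₃ Sv h).KΓ Γ = satLevelRegimeOf V h Γ.K := rfl

/-- (RUN-34 revision) the archimedean component of the pinned input is level-free. -/
theorem thetaSpaceInputIn_ιinf_apply (Sv : ThetaAdelicSide V c) (h : IsAnisotropic L V.Hm)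
    (Γ Γ' : Level V) :
    (thetaSpaceInputIn hHD hI h₁ h₃ Sv h).ιinf Γ' = (thetaSpaceInputIn hHD hI h₁ h₃ Sv h).ιinf Γ := rfl

end Pin

/-! ### § 4. E's `classPacks` from `Nonempty` supply situations -/

section NonemptySupply

variable (hHD : exists_isReal_hodgeModel) (hI : hodgePQ_independent_of_hodgeModel)
  (h₁ : BallQuotientUniformised)  (h₃ : CMAbelianVarietyRealised)

/-- **E's `classPacks` at the END STATE's model from the mere EXISTENCE of supply situations** per good sextic
context, `k ∈ {0,1}`, `N > 0` (so that a producer may transport along the regime equation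
`thetaSpaceInputOf_of_isAnisotropic` inside `Prop`). -/
theorem classPacksOf_nonempty (h : Bool)
    (emb : ∀ {L : CMField} {ι₁ : L →+* ℂ} {V : HermSpace3 L ι₁} (Γ : Level V),
      (picardCMUniverse hHD hI h₁ h₃).CohC ((picardCMUniverse hHD hI h₁ h₃).pms L ι₁ V Γ) 2 →ₗ[ℂ]
        (V.latticeModel printFact_unitaryCompact_holds).toQuotientModel.H)
    (cover : ∀ {L : CMField} {ι₁ : L →+* ℂ} {V : HermSpace3 L ι₁} (Γ Γ' : Level V),
      Γ'.Γ ≤ Γ.Γ → (picardCMUniverse hHD hI h₁ h₃).Mor ((picardCMUniverse hHD hI h₁ h₃).pms L ι₁ V Γ')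
        ((picardCMUniverse hHD hI h₁ h₃).pms L ι₁ V Γ))
    (wm : ∀ {L : CMField} {ι₁ : L →+* ℂ} (V : HermSpace3 L ι₁) (c : SeesawCtx L),
      WeilThetaModel (V.latticeModel printFact_unitaryCompact_holds).toQuotientModel.G
        (V.latticeModel printFact_unitaryCompact_holds).toQuotientModel.Γ
        (c.D.latticeModelW printFact_unitaryCompact_holds).toQuotientModel.G
        (c.D.latticeModelW printFact_unitaryCompact_holds).toQuotientModel.Γ)
    (X : ∀ {L : CMField} {ι₁ : L →+* ℂ} (V : HermSpace3 L ι₁) (c : SeesawCtx L),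
      ThetaSpaceInput (picardCMUniverse hHD hI h₁ h₃) V c)
    (d12 d34 : ∀ {L : CMField}, SeesawCtx L → HodgeCM.Universe.SideData L)
    (A : ∀ {L : CMField} {ι₁ : L →+* ℂ} (V : HermSpace3 L ι₁) (c : SeesawCtx L),
      (thetaModelOf hHD hI h₁ h₃ h emb cover wm (thetaOf _ (thetaClassInputOf _ X)) d12 d34).GoodCtx ι₁ c →
      Module.finrank ℚ c.K = 6 → ∀ k : Fin 4, k = 0 ∨ k = 1 → ∀ N : ℕ, 0 < N →
        Nonempty (SupplySituationAt (X V c) k N))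
    {L : CMField} {ι₁ : L →+* ℂ} (V : HermSpace3 L ι₁) (c : SeesawCtx L)
    (hc : (thetaModelOf hHD hI h₁ h₃ h emb cover wm (thetaOf _ (thetaClassInputOf _ X)) d12 d34).GoodCtx ι₁ c)
    (h6 : Module.finrank ℚ c.K = 6) :
    Nonempty (ClassSupplyPackN
        (thetaModelOf hHD hI h₁ h₃ h emb cover wm (thetaOf _ (thetaClassInputOf _ X)) d12 d34) V c 0) ∧
      Nonempty (ClassSupplyPackN
        (thetaModelOf hHD hI h₁ h₃ h emb cover wm (thetaOf _ (thetaClassInputOf _ X)) d12 d34) V c 1) :=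
  classPacksOf_thetaModelOf hHD hI h₁ h₃ h emb cover wm X d12 d34
    (fun V c hc h6 k hk N hN => Classical.choice (A V c hc h6 k hk N hN)) V c hc h6

end NonemptySupply


/-! ### § 5. E's `classPacks` AT THE PIN from archimedean `K`-type data in the regime -/

section PinSupply

variable (hHD : exists_isReal_hodgeModel) (hI : hodgePQ_independent_of_hodgeModel)
  (h₁ : BallQuotientUniformised)  (h₃ : CMAbelianVarietyRealised)

/-- A good context of a sextic CM field forces `4 ≤ [L:ℚ]` (the types' field embeds in `L`). -/
theorem four_le_finrank_of_goodCtx {U : Universe} {T : U.ThetaModel} {L : CMField} {ι₁ : L →+* ℂ}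
    {c : SeesawCtx L} (hc : T.GoodCtx ι₁ c) (h6 : Module.finrank ℚ c.K = 6) : 4 ≤ Module.finrank ℚ L := by
  obtain ⟨j, -, -⟩ := hc.forced
  have hj : Module.finrank ℚ c.K ≤ Module.finrank ℚ L :=
    LinearMap.finrank_le_finrank_of_injective (f := j.toRatAlgHom.toLinearMap) j.injective
  omega

/-- … hence the regime: `V.Hm` is anisotropic. -/
theorem isAnisotropic_of_goodCtx {U : Universe} {T : U.ThetaModel} {L : CMField} {ι₁ : L →+* ℂ}
    (V : HermSpace3 L ι₁) {c : SeesawCtx L} (hc : T.GoodCtx ι₁ c) (h6 : Module.finrank ℚ c.K = 6) :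
    IsAnisotropic L V.Hm :=
  V.isAnisotropic (four_le_finrank_of_goodCtx hc h6)

/-- **E's `classPacks` AT THE PIN `X := thetaSpaceInputOf … S`**: from, per good sextic context (regime `hV`
supplied), `k ∈ {0,1}`, `N > 0`, one `ArchKTypeData` over the REGIME input `thetaSpaceInputIn … (S V c) hV` and the
holomorphy (W6b-hol) of its restricted theta forms; the regime transport is propositional
(`classPacksOf_nonempty` + `thetaSpaceInputOf_of_isAnisotropic`). -/
theorem classPacksOf_pin (h : Bool)
    (emb : ∀ {L : CMField} {ι₁ : L →+* ℂ} {V : HermSpace3 L ι₁} (Γ : Level V),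
      (picardCMUniverse hHD hI h₁ h₃).CohC ((picardCMUniverse hHD hI h₁ h₃).pms L ι₁ V Γ) 2 →ₗ[ℂ]
        (V.latticeModel printFact_unitaryCompact_holds).toQuotientModel.H)
    (cover : ∀ {L : CMField} {ι₁ : L →+* ℂ} {V : HermSpace3 L ι₁} (Γ Γ' : Level V),
      Γ'.Γ ≤ Γ.Γ → (picardCMUniverse hHD hI h₁ h₃).Mor ((picardCMUniverse hHD hI h₁ h₃).pms L ι₁ V Γ')
        ((picardCMUniverse hHD hI h₁ h₃).pms L ι₁ V Γ))
    (wm : ∀ {L : CMField} {ι₁ : L →+* ℂ} (V : HermSpace3 L ι₁) (c : SeesawCtx L),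
      WeilThetaModel (V.latticeModel printFact_unitaryCompact_holds).toQuotientModel.G
        (V.latticeModel printFact_unitaryCompact_holds).toQuotientModel.Γ
        (c.D.latticeModelW printFact_unitaryCompact_holds).toQuotientModel.G
        (c.D.latticeModelW printFact_unitaryCompact_holds).toQuotientModel.Γ)
    (S : ∀ {L : CMField} {ι₁ : L →+* ℂ} (V : HermSpace3 L ι₁) (c : SeesawCtx L), ThetaAdelicSide V c)
    (d12 d34 : ∀ {L : CMField}, SeesawCtx L → HodgeCM.Universe.SideData L)
    (C : ∀ {L : CMField} {ι₁ : L →+* ℂ} (V : HermSpace3 L ι₁) (c : SeesawCtx L) (hV : IsAnisotropic L V.Hm),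
      (thetaModelOf hHD hI h₁ h₃ h emb cover wm
        (thetaOf _ (thetaClassInputOf _ (fun V c => thetaSpaceInputOf hHD hI h₁ h₃ S V c))) d12 d34).GoodCtx
          ι₁ c →
      Module.finrank ℚ c.K = 6 → ∀ k : Fin 4, k = 0 ∨ k = 1 → ∀ N : ℕ, 0 < N →
        ArchKTypeData (thetaSpaceInputIn hHD hI h₁ h₃ (S V c) hV) k N)
    (hol : ∀ {L : CMField} {ι₁ : L →+* ℂ} (V : HermSpace3 L ι₁) (c : SeesawCtx L) (hV : IsAnisotropic L V.Hm)
      (hc : (thetaModelOf hHD hI h₁ h₃ h emb cover wm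
        (thetaOf _ (thetaClassInputOf _ (fun V c => thetaSpaceInputOf hHD hI h₁ h₃ S V c))) d12 d34).GoodCtx
          ι₁ c)
      (h6 : Module.finrank ℚ c.K = 6) (k : Fin 4) (hk : k = 0 ∨ k = 1) (N : ℕ) (hN : 0 < N),
      ∀ f ∈ ((thetaSpaceInputIn hHD hI h₁ h₃ (S V c) hV).P k).weightFunctions,
        (C V c hV hc h6 k hk N hN).toProduct.restrictedThetaForm f ∈
          ((thetaSpaceInputIn hHD hI h₁ h₃ (S V c) hV).D (C V c hV hc h6 k hk N hN).Γ₀).Hol)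
    {L : CMField} {ι₁ : L →+* ℂ} (V : HermSpace3 L ι₁) (c : SeesawCtx L)
    (hc : (thetaModelOf hHD hI h₁ h₃ h emb cover wm
      (thetaOf _ (thetaClassInputOf _ (fun V c => thetaSpaceInputOf hHD hI h₁ h₃ S V c))) d12 d34).GoodCtx
        ι₁ c)
    (h6 : Module.finrank ℚ c.K = 6) :
    Nonempty (ClassSupplyPackN (thetaModelOf hHD hI h₁ h₃ h emb cover wm
        (thetaOf _ (thetaClassInputOf _ (fun V c => thetaSpaceInputOf hHD hI h₁ h₃ S V c))) d12 d34) V c 0) ∧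
      Nonempty (ClassSupplyPackN (thetaModelOf hHD hI h₁ h₃ h emb cover wm
        (thetaOf _ (thetaClassInputOf _ (fun V c => thetaSpaceInputOf hHD hI h₁ h₃ S V c))) d12 d34) V c 1) :=
  classPacksOf_nonempty hHD hI h₁ h₃ h emb cover wm (fun V c => thetaSpaceInputOf hHD hI h₁ h₃ S V c) d12 d34
    (fun V c hc h6 k hk N hN => by
      have hV := isAnisotropic_of_goodCtx V hc h6
      show Nonempty (SupplySituationAt (thetaSpaceInputOf hHD hI h₁ h₃ S V c) k N)
      rw [thetaSpaceInputOf_of_isAnisotropic hHD hI h₁ h₃ S V c hV]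
      exact ⟨(C V c hV hc h6 k hk N hN).toSupplySituationAt (hol V c hV hc h6 k hk N hN)⟩)
    V c hc h6

end PinSupply

end Model
end HodgeCM

end
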